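/-
Copyright: pub-rosobs cell (Resolution Observatory), carver gen 49.  Companion file; statements OURS — the
numerical (GAP) hypothesis of the cell's LEMMA CF in the toy weighted-centre model (engine 1 gen 32,
THEOREM-Theta6 §2 (GAP), §5 PROPOSITION RIG STEP 3; CARVER-NOTES-eng1-g32 T6), as grid-free rational
inequalities.  Instrument — NOT a resolution theorem, NOT a statement about the invariant of
[AbramovichTemkinWlodarczyk2024] on power series, NOT summit progress.
-/
import Mathlib.Algebra.Order.Field.Rat
import Mathlib.Tactic.Linarith
import Mathlib.Tactic.NormNum
import Mathlib.Tactic.Ring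
import HarnessLib

/-!
# (GAP) tables of PROPOSITION RIG — grid-free

In the cell's toy model the slot weights of a maximal weighted centre are rationals `w ∈ (0, 1/2]`; those above `1/5`
are confined to the five values `U = {5/24, 2/9, 1/4, 1/3, 1/2}` (cell LEMMA G), those `≤ 1/5` are unrestricted
("dense").  LEMMA CF (typed in `WeightedCentreConstantField` / `WeightedCentreRectification`) is applied in §5 STEP 3
of the cell's THEOREM-Theta6 to the layer derivation of a `σ^s`-layer carried by a lightest class `w₀ > sρ`, with
weight drop `β = w₀ − sρ`, under the purely numerical hypothesis

  (GAP)  for every class `wᵢ ≥ w₀`, no H-monomial weight lies in the half-open interval `(wᵢ − w₀, wᵢ − w₀ + β]`,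

where the H-monomial weights are taken CONSERVATIVELY (a superset): every `U`-weight `≥ w₀`, every dense weight in
`[w₀, 1/5]`, and every rational `≥ 2w₀` (sums of at least two H-slots).  The cell checked (GAP) on rational grids
(`gapcheck32.py`, denominators 720 / 1440); this file states and proves the six table lines of STEP 3 for ALL
rationals in the stated windows (`linarith` facts), the sharpness at `ρ = 1/24` (REMARK §5 (a)), and the two
`p`-side conditions of STEP 3 (factorials `w₀ > 1/(2p)`, pin `p·w₀ > 1` or `1/(p+1) < w₀ < 1/p`).

Everything here is "formalisation ours" of cell arithmetic; the only published input is the weight normalisation of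
weighted centres. [cite: AbramovichTemkinWlodarczyk2024, §5.1 (p. 1575)]

## Main statements
* `GapCondition w₀ β` : (GAP) for lightest class `w₀` and drop `β` against every class `wᵢ ≥ w₀` (U or dense).
* `gapCondition_half`, `gapCondition_third`, `gapCondition_quarter`, `gapCondition_two_ninths`,
  `gapCondition_five_24ths`, `gapCondition_dense` : the table (classes V, M, W, 2/9, 5/24, dense), each for its
  full window of drops `β` (equivalently of `ρ`); `gapCondition_third_layer_four` etc.: the `ρ`-form used in STEP 3.
* `not_gapCondition_third_sixth` : sharpness — at `ρ = 1/24`, layer 4, class `M = 1/3` (`β = 1/6`) (GAP) FAILS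
  (witness: the H-weight `1/3` in `(1/6, 1/3]`).
* `factorial_condition_of_le`, `pin_condition_U`, `pin_condition_dense` : the `p`-side checks of STEP 3.
-/

namespace Literature.AlgebraicGeometry.Resolution.WeightedBlowup

/-! ## The objects -/

/-- The five slot weights above `1/5` (cell LEMMA G): `U = {5/24, 2/9, 1/4, 1/3, 1/2}` (formalisation ours).
[cite: AbramovichTemkinWlodarczyk2024, §5.1 (p. 1575)] -/
def IsUWeight (u : ℚ) : Prop := u = 5 / 24 ∨ u = 2 / 9 ∨ u = 1 / 4 ∨ u = 1 / 3 ∨ u = 1 / 2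

/-- A slot-weight CLASS of the toy model: a `U`-weight or a dense weight `≤ 1/5` (formalisation ours).
[cite: AbramovichTemkinWlodarczyk2024, §5.1 (p. 1575)] -/
def IsClassWeight (w : ℚ) : Prop := IsUWeight w ∨ w ≤ 1 / 5

/-- CONSERVATIVE H-monomial weights for the lightest class `w₀`: a `U`-single `≥ w₀`, a dense single in `[w₀, 1/5]`,
or anything `≥ 2w₀` (a sum of at least two H-slots) (formalisation ours; a superset of the true H-monomial weights).
[cite: AbramovichTemkinWlodarczyk2024, §5.1 (p. 1575)] -/
def IsConsHWeight (w₀ h : ℚ) : Prop := (IsUWeight h ∧ w₀ ≤ h) ∨ (w₀ ≤ h ∧ h ≤ 1 / 5) ∨ 2 * w₀ ≤ h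

/-- (GAP) against ONE class `wᵢ`: no conservative H-weight in `(wᵢ − w₀, wᵢ − w₀ + β]` (formalisation ours).
[cite: AbramovichTemkinWlodarczyk2024, §5.1 (p. 1575)] -/
def GapAt (w₀ β wᵢ : ℚ) : Prop := ∀ h, IsConsHWeight w₀ h → ¬(wᵢ - w₀ < h ∧ h ≤ wᵢ - w₀ + β)

/-- **(GAP)** for the lightest class `w₀` and the drop `β`: `GapAt` against EVERY class `wᵢ ≥ w₀` (formalisation
ours; THEOREM-Theta6 §2 (GAP) with the conservative H-weights of §5 STEP 3).
[cite: AbramovichTemkinWlodarczyk2024, §5.1 (p. 1575)] -/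
def GapCondition (w₀ β : ℚ) : Prop := ∀ wᵢ, IsClassWeight wᵢ → w₀ ≤ wᵢ → GapAt w₀ β wᵢ

/-! ## The table of §5 STEP 3 (each line for its full window of drops `β`) -/

/-- Class `V = 1/2` (any layer): (GAP) holds for every drop `0 < β < 1/2` — only the same-class interval `(0, β]`
occurs and every H-weight is `≥ 1/2` (derived here). [cite: AbramovichTemkinWlodarczyk2024, §5.1 (p. 1575)] -/
theorem gapCondition_half {β : ℚ} (hβ : β < 1 / 2) : GapCondition (1 / 2) β := by
  intro wᵢ hwᵢ hle h hh ⟨h1, h2⟩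
  rcases hwᵢ with (rfl | rfl | rfl | rfl | rfl) | hd <;>
    rcases hh with ⟨(rfl | rfl | rfl | rfl | rfl), hw⟩ | ⟨hw, hw'⟩ | hw <;> linarith

/-- Class `M = 1/3` (layers 4, 5, 7): (GAP) holds for every drop `0 < β < 1/6`, i.e. `sρ > 1/6` (derived here;
the class-`V` interval `(1/6, 1/6 + β]` misses `1/3` iff `β < 1/6`). [cite: AbramovichTemkinWlodarczyk2024, §5.1 (p. 1575)] -/
theorem gapCondition_third {β : ℚ} (hβ : β < 1 / 6) : GapCondition (1 / 3) β := by
  intro wᵢ hwᵢ hle h hh ⟨h1, h2⟩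
  rcases hwᵢ with (rfl | rfl | rfl | rfl | rfl) | hd <;>
    rcases hh with ⟨(rfl | rfl | rfl | rfl | rfl), hw⟩ | ⟨hw, hw'⟩ | hw <;> linarith

/-- Class `W = 1/4` (layers 4, 5): (GAP) holds for every drop `0 < β < 1/12` (derived here; intervals `(0, β]`,
`(1/12, 1/12 + β] ⊂ (1/12, 1/6)`, `(1/4, 1/4 + β] ⊂ (1/4, 1/3)`; this is the numerical half of the cell's LEMMA W4).
[cite: AbramovichTemkinWlodarczyk2024, §5.1 (p. 1575)] -/
theorem gapCondition_quarter {β : ℚ} (hβ : β < 1 / 12) : GapCondition (1 / 4) β := by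
  intro wᵢ hwᵢ hle h hh ⟨h1, h2⟩
  rcases hwᵢ with (rfl | rfl | rfl | rfl | rfl) | hd <;>
    rcases hh with ⟨(rfl | rfl | rfl | rfl | rfl), hw⟩ | ⟨hw, hw'⟩ | hw <;> linarith

/-- Class `2/9` (layers 4, 5): (GAP) holds for every drop `0 < β < 1/18` (derived here; intervals `(0, β]`,
`(1/36, 1/36 + β]`, `(1/9, 1/9 + β]`, `(5/18, 5/18 + β] ⊂ (5/18, 1/3)`). [cite: AbramovichTemkinWlodarczyk2024, §5.1 (p. 1575)] -/
theorem gapCondition_two_ninths {β : ℚ} (hβ : β < 1 / 18) : GapCondition (2 / 9) β := by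
  intro wᵢ hwᵢ hle h hh ⟨h1, h2⟩
  rcases hwᵢ with (rfl | rfl | rfl | rfl | rfl) | hd <;>
    rcases hh with ⟨(rfl | rfl | rfl | rfl | rfl), hw⟩ | ⟨hw, hw'⟩ | hw <;> linarith

/-- Class `5/24` (layer 4): (GAP) holds for every drop `0 < β < 1/24` (derived here; intervals `(0, β]`,
`(1/72, 1/72 + β]`, `(1/24, 1/24 + β]`, `(1/8, 1/8 + β]`, `(7/24, 7/24 + β] ⊂ (7/24, 1/3)`).
[cite: AbramovichTemkinWlodarczyk2024, §5.1 (p. 1575)] -/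
theorem gapCondition_five_24ths {β : ℚ} (hβ : β < 1 / 24) : GapCondition (5 / 24) β := by
  intro wᵢ hwᵢ hle h hh ⟨h1, h2⟩
  rcases hwᵢ with (rfl | rfl | rfl | rfl | rfl) | hd <;>
    rcases hh with ⟨(rfl | rfl | rfl | rfl | rfl), hw⟩ | ⟨hw, hw'⟩ | hw <;> linarith

/-- Dense lightest class `w₀ ∈ (4ρ, 1/5]` (layer 4 only), `1/24 < ρ`: (GAP) holds with the drop `β = w₀ − 4ρ`
(derived here; all intervals lie below `w₀ > 1/6` except the class-`V` one, `(1/2 − w₀, 1/2 − 4ρ] ⊂ [3/10, 1/3)`,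
which misses every single (`≤ 1/4` or `= 1/3` excluded since `ρ > 1/24`, or `1/2`) and every sum (`≥ 2w₀ > 1/3`)).
[cite: AbramovichTemkinWlodarczyk2024, §5.1 (p. 1575)] -/
theorem gapCondition_dense {w₀ ρ : ℚ} (hρ : 1 / 24 < ρ) (hw : 4 * ρ < w₀) (hw' : w₀ ≤ 1 / 5) :
    GapCondition w₀ (w₀ - 4 * ρ) := by
  intro wᵢ hwᵢ hle h hh ⟨h1, h2⟩
  rcases hwᵢ with (rfl | rfl | rfl | rfl | rfl) | hd <;>
    rcases hh with ⟨(rfl | rfl | rfl | rfl | rfl), hw⟩ | ⟨hw, hw'⟩ | hw <;> linarith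

/-- The extra continuum check of `gapcheck32.py` for dense heavier classes: the union of the intervals over
`wᵢ ∈ [w₀, 1/5]` is `(0, 1/5 − 4ρ]`, which lies below `w₀` (derived here). [cite: AbramovichTemkinWlodarczyk2024, §5.1 (p. 1575)] -/
theorem dense_continuum_below {w₀ ρ : ℚ} (hρ : 1 / 24 < ρ) (hw : 4 * ρ < w₀) : 1 / 5 - 4 * ρ < w₀ := by
  linarith

/-! ## The `ρ`-form used in STEP 3 (layer `s`, drop `β = w₀ − sρ`) -/

/-- `M` carries layer `s ∈ {4, 5, 7}` with `sρ > 1/6` (for `s = 4`: `ρ > 1/24`): (GAP) holds (derived here).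
[cite: AbramovichTemkinWlodarczyk2024, §5.1 (p. 1575)] -/
theorem gapCondition_third_layer {s ρ : ℚ} (h : 1 / 6 < s * ρ) : GapCondition (1 / 3) (1 / 3 - s * ρ) :=
  gapCondition_third (by linarith)

/-- Layer 4 at class `M` on the window `ρ > 1/24` (derived here). [cite: AbramovichTemkinWlodarczyk2024, §5.1 (p. 1575)] -/
theorem gapCondition_third_layer_four {ρ : ℚ} (hρ : 1 / 24 < ρ) : GapCondition (1 / 3) (1 / 3 - 4 * ρ) :=
  gapCondition_third_layer (s := 4) (by linarith)

/-- `W` carries layer `s ∈ {4, 5}` with `sρ > 1/6`: (GAP) holds (derived here; LEMMA W4's numerical input).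
[cite: AbramovichTemkinWlodarczyk2024, §5.1 (p. 1575)] -/
theorem gapCondition_quarter_layer {s ρ : ℚ} (h : 1 / 6 < s * ρ) : GapCondition (1 / 4) (1 / 4 - s * ρ) :=
  gapCondition_quarter (by linarith)

/-- `2/9` carries layer `s ∈ {4, 5}` with `sρ > 1/6`: (GAP) holds (derived here). [cite: AbramovichTemkinWlodarczyk2024, §5.1 (p. 1575)] -/
theorem gapCondition_two_ninths_layer {s ρ : ℚ} (h : 1 / 6 < s * ρ) : GapCondition (2 / 9) (2 / 9 - s * ρ) :=
  gapCondition_two_ninths (by linarith)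

/-- `5/24` carries layer 4 with `ρ > 1/24`: (GAP) holds (derived here). [cite: AbramovichTemkinWlodarczyk2024, §5.1 (p. 1575)] -/
theorem gapCondition_five_24ths_layer_four {ρ : ℚ} (hρ : 1 / 24 < ρ) : GapCondition (5 / 24) (5 / 24 - 4 * ρ) :=
  gapCondition_five_24ths (by linarith)

/-- `V` carries any layer `s` with `0 < sρ`: (GAP) holds (derived here). [cite: AbramovichTemkinWlodarczyk2024, §5.1 (p. 1575)] -/
theorem gapCondition_half_layer {s ρ : ℚ} (h : 0 < s * ρ) : GapCondition (1 / 2) (1 / 2 - s * ρ) :=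
  gapCondition_half (by linarith)

/-! ## Sharpness at `ρ = 1/24` (REMARK §5 (a)) -/

/-- At `ρ = 1/24`, layer 4, class `M`: `β = 1/3 − 4/24 = 1/6` and the class-`V` interval `(1/6, 1/3]` CONTAINS the
H-weight `1/3` — (GAP) fails; the window `ρ > 1/24` of `gapCondition_third_layer_four` is sharp (derived here).
[cite: AbramovichTemkinWlodarczyk2024, §5.1 (p. 1575)] -/
theorem not_gapCondition_third_sixth : ¬GapCondition (1 / 3) (1 / 6) := by
  intro h
  have h13 : IsUWeight (1 / 3 : ℚ) := Or.inr (Or.inr (Or.inr (Or.inl rfl)))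
  exact h (1 / 2) (Or.inl (Or.inr (Or.inr (Or.inr (Or.inr rfl))))) (by norm_num) (1 / 3) (Or.inl ⟨h13, le_rfl⟩)
    ⟨by norm_num, by norm_num⟩

/-- The same failure in `ρ`-form: `β = 1/3 − 4·(1/24)` (derived here). [cite: AbramovichTemkinWlodarczyk2024, §5.1 (p. 1575)] -/
theorem not_gapCondition_third_layer_four_at_one_24th : ¬GapCondition (1 / 3) (1 / 3 - 4 * (1 / 24)) := by
  norm_num [not_gapCondition_third_sixth]

/-- Monotonicity: (GAP) for a drop `β` implies (GAP) for every smaller drop (derived here; so each table line covers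
its whole window). [cite: AbramovichTemkinWlodarczyk2024, §5.1 (p. 1575)] -/
theorem GapCondition.mono {w₀ β β' : ℚ} (h : GapCondition w₀ β) (hle : β' ≤ β) : GapCondition w₀ β' :=
  fun wᵢ hwᵢ hw h' hh' ⟨h1, h2⟩ => h wᵢ hwᵢ hw h' hh' ⟨h1, h2.trans (by linarith)⟩

/-! ## The `p`-side checks of STEP 3 -/

/-- Factorial condition `w₀ > 1/(2p)` for every class `w₀ > 1/8` and every `p ≥ 5` (derived here; in STEP 3 every
carrying class has `w₀ > 3ρ > 1/8`). [cite: AbramovichTemkinWlodarczyk2024, §5.1 (p. 1575)] -/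
theorem factorial_condition {w₀ : ℚ} {p : ℕ} (hp : 5 ≤ p) (hw : 1 / 8 < w₀) : 1 / (2 * (p : ℚ)) < w₀ := by
  have hp' : (5 : ℚ) ≤ p := by exact_mod_cast hp
  rw [div_lt_iff₀ (by linarith)]
  nlinarith

/-- Pin condition for the `U`-classes: `p·w₀ > 1` for every `w₀ ≥ 5/24` and `p ≥ 5` (derived here).
[cite: AbramovichTemkinWlodarczyk2024, §5.1 (p. 1575)] -/
theorem pin_condition_U {w₀ : ℚ} {p : ℕ} (hp : 5 ≤ p) (hw : 5 / 24 ≤ w₀) : 1 < (p : ℚ) * w₀ := by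
  have hp' : (5 : ℚ) ≤ p := by exact_mod_cast hp
  nlinarith

/-- Pin condition for a dense lightest class `w₀ ∈ (1/6, 1/5]`: for `p ≥ 7`, `p·w₀ > 1` (derived here).
[cite: AbramovichTemkinWlodarczyk2024, §5.1 (p. 1575)] -/
theorem pin_condition_dense {w₀ : ℚ} {p : ℕ} (hp : 7 ≤ p) (hw : 1 / 6 < w₀) : 1 < (p : ℚ) * w₀ := by
  have hp' : (7 : ℚ) ≤ p := by exact_mod_cast hp
  nlinarith

/-- … and for `p = 5` the dense class `w₀ ∈ (1/6, 1/5)` lies in the window `(1/(p+1), 1/p)` of CF (3), while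
`w₀ = 1/5 = 1/p` is the excluded Frobenius-pin value (derived here; why PROPOSITION RIG (a) stops at `ρ = 1/20` for
`p = 5`). [cite: AbramovichTemkinWlodarczyk2024, §5.1 (p. 1575)] -/
theorem pin_window_dense_five {w₀ : ℚ} (hw : 1 / 6 < w₀) (hw' : w₀ < 1 / 5) :
    1 / ((5 : ℚ) + 1) < w₀ ∧ w₀ < 1 / (5 : ℚ) := by
  constructor <;> norm_num <;> linarith

/-- Endgame condition of STEP 4: `3ρ ≥ 1/12` on the window `ρ > 1/24` (derived here). [cite: AbramovichTemkinWlodarczyk2024, §5.1 (p. 1575)] -/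
theorem endgame_condition {ρ : ℚ} (hρ : 1 / 24 < ρ) : 1 / 12 ≤ 3 * ρ := by
  linarith

end Literature.AlgebraicGeometry.Resolution.WeightedBlowup
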